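import Literature.Probability.LatticeModels.SixVertexShiftOperator
import Literature.LinearAlgebra.Matrix.UnitaryTraceLimit

/-!
# Six-vertex model: the joint eigenbasis of `t(π/2)` and `T(0)`, the simple top index, and the
# spectral representation of vertical-arrow correlations (DKLM 2026, Theorem 23, Step 1)

H. Duminil-Copin, K. K. Kozlowski, P. Lammers, I. Manolescu, *Gaussian free field convergence of
the six-vertex model with `-1 ≤ Δ ≤ -1/2`*, arXiv:2603.06268 (2026) [DKLM2026SixVertexGFF]
(`paper:arxiv-2603.06268`, chunks p0018, p0043–p0044):

> **Theorem 23** (Spectral representation of the two-point function). Fix `c > 0` and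
> `L ∈ 2ℤ_{>0}`. Then, there exists a finite positive measure `μ_L` on `ℝ_{>0} × ℝ` such that
> `Φ_{CYL_L,2}(u) = ∫ ((1-a)^{x₂} e^{-iby₂} - 1)(1-a)^{x₁'} e^{-iby₁'} (1 - (1-a)^{x₁} e^{-iby₁}) dμ_L(a,b)`
> for any horizontally ordered `u`, and which is supported on the set `(0,2] × [-π,π]` […].
> Furthermore, `μ_L({|b| ∈ (0, 2π/L)}) = 0`.
> *Proof.* […] `μ_L := ∑_{k>0} |v_k† S(π/2) v_0|² / (1 - Λ_k(π/2))² δ_{(1-Λ_k(π/2), -i log Λ_k(0))}`.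
> […] **Step 1** (`y₁ = y₂ = 0`): when `u₁'-u₁ = u₂'-u₂ = (1,0)` we are just calculating an
> arrow-arrow correlation between vertical arrows:
> `Φ_{CYL_L,2}(u) = v_0† S T(π/2)^{x₁'} T(0)^{-y₁'} S v_0 = -∑_{k>0} |v_k† S v_0|² Λ_k(π/2)^{x₁'} Λ_k(0)^{-y₁'}`.
> **Lemma 60.** The basis `(v_k)_k` may be chosen such that it diagonalises `T(0)` as well […]
> `Λ_0(0) = 1`.

This file fixes the circumference `L = 2(ℓ+1)`, `a = b = 1`, `c > 0`, and assembles: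

1. Generic linear algebra: real and imaginary parts of complex eigenvectors of a real matrix
   (`mulVec_re_of_cpx_mulVec`, `mulVec_im_of_cpx_mulVec`); eigenvalue bounds `2δ - Λ ≤ μ ≤ Λ`
   for any real eigenpair of a nonnegative symmetric matrix with diagonal `≥ δ`
   (`eigenvalue_le_topEigenvalue_of_mulVec`, `two_mul_sub_topEigenvalue_le_of_mulVec`).
2. **The joint eigenbasis of `t_𝔅 = t(π/2)` and `T(0)`** (Lemma 60, from
   `JointEigenbasis.lean`): `transferJointUnitary c ℓ = W` (unitary), `transferJointEigenvalue`
   (`λ_k`, real: `t_𝔅 W = W diag λ`), `transferJointPhase` (`ω_k`: `T(0) W = W diag ω`,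
   `|ω_k| = 1`, `ω_k^L = 1`).
3. **The simple top index** (Lemma 57 + Lemma 60): `perronVec` (`v_0 > 0`, `t v_0 = Λ v_0`), the
   bounds `-Λ < λ_k ≤ Λ`, uniqueness and existence of `k` with `λ_k = Λ` (`topIdx`), strict
   bound `|λ_k| < Λ` off the top index, and **`transferJointPhase_topIdx : ω_{k₀} = 1`**
   (`Λ_0(0) = 1`).
4. **Theorem 23, Step 1.** `arrowMatrix_natCast` (`s_m = (T(0)ᵀ)^m s_0 T(0)^m`), the coefficients
   `topArrowCoeff c hc ℓ k = m_k = (W⋆ (s_0)_ℂ W)_{k₀k}` (the source's `v_k† S v_0` up to the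
   normalisation `Λ` and conjugation), `conj_arrowMatrix_top_apply` / `conj_arrowMatrix_apply_top`
   (`(W⋆ s_m W)_{k₀k} = m_k ω_k^m`, `(W⋆ s_m W)_{kk₀} = ω̄_k^m (W⋆ s_0 W)_{kk₀}`), the anti-Hermitian
   symmetry `conj_arrowMatrix_zero_apply_top` (Lemma 61), **`topArrowCoeff_topIdx : m_{k₀} = 0`**
   (`v_0† S v_0 = 0`), and **`cylinderPairExp_arrowObs_eq`**:
   `𝔼_{CYL_L}[α_{y₁} · τ_{(1+x',0)} α_{y₂}] = -(∑_k |m_k|² λ_k^{x'} ω_k^{y₁} ω̄_k^{y₂}) / Λ^{x'+2}`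
   — the identity `Φ_{CYL_L,2} = -∑_{k>0} |v_k† S v_0|² Λ_k(π/2)^{x₁'} Λ_k(0)^{-y₁'}` for
   horizontally adjacent pairs of the proof of Theorem 23 (the real cylinder correlation of
   Theorem 26 / Lemma 22 identified with the complex trace limit in the joint eigenbasis,
   `UnitaryTraceLimit.lean`). The measure `μ_L` of Theorem 23 is then the finite family of atoms
   `(1 - λ_k/Λ, arg ω_k)` with weights `|m_k|²/(Λ² (1-λ_k/Λ)²)`, `k ≠ k₀` (sequel).

## References

* H. Duminil-Copin, K. K. Kozlowski, P. Lammers, I. Manolescu, arXiv:2603.06268 (2026), Theorem 23,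
  Part III §3 (Lemmas 60, 61, proof of Theorem 23, Step 1). [DKLM2026SixVertexGFF]
-/

noncomputable section

open Finset Matrix Filter Topology
open Literature.LinearAlgebra.Matrix

/-! ## 1. Generic linear algebra: real eigenpairs from complex eigenvectors, eigenvalue bounds -/

namespace Literature.LinearAlgebra.Matrix

variable {n : Type*} [Fintype n] [DecidableEq n]

omit [DecidableEq n] in
/-- Real part of a complex eigenvector of a real matrix (real eigenvalue) is an eigenvector.
[folklore] -/
theorem mulVec_re_of_cpx_mulVec {A : Matrix n n ℝ} {w : n → ℂ} {μ : ℝ}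
    (h : cpx A *ᵥ w = (μ : ℂ) • w) : A *ᵥ (fun i => (w i).re) = μ • fun i => (w i).re := by
  funext i
  have hi := congrArg Complex.re (congrFun h i)
  simp only [Matrix.mulVec, dotProduct, cpx_apply, Pi.smul_apply, smul_eq_mul, Complex.re_sum,
    Complex.re_ofReal_mul] at hi
  simpa [Matrix.mulVec, dotProduct] using hi

omit [DecidableEq n] in
/-- Imaginary part of a complex eigenvector of a real matrix (real eigenvalue) is an eigenvector.
[folklore] -/
theorem mulVec_im_of_cpx_mulVec {A : Matrix n n ℝ} {w : n → ℂ} {μ : ℝ}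
    (h : cpx A *ᵥ w = (μ : ℂ) • w) : A *ᵥ (fun i => (w i).im) = μ • fun i => (w i).im := by
  funext i
  have hi := congrArg Complex.im (congrFun h i)
  simp only [Matrix.mulVec, dotProduct, cpx_apply, Pi.smul_apply, smul_eq_mul, Complex.im_sum,
    Complex.im_ofReal_mul] at hi
  simpa [Matrix.mulVec, dotProduct] using hi

omit [Fintype n] [DecidableEq n] in
/-- A complex vector is the combination of its real and imaginary parts. [folklore] -/
theorem eq_re_add_I_im (w : n → ℂ) :
    w = (fun i => ((w i).re : ℂ)) + Complex.I • fun i => ((w i).im : ℂ) := by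
  funext i
  simp only [Pi.add_apply, Pi.smul_apply, smul_eq_mul]
  rw [mul_comm]
  exact (Complex.re_add_im (w i)).symm

/-- **`μ ≤ Λ`** for any real eigenpair `A v = μ v`, `v ≠ 0`, of a real symmetric matrix
(Rayleigh bound). [folklore] -/
theorem eigenvalue_le_topEigenvalue_of_mulVec [Nonempty n] {A : Matrix n n ℝ} (hA : A.IsHermitian)
    {v : n → ℝ} {μ : ℝ} (hv : v ≠ 0) (h : A *ᵥ v = μ • v) : μ ≤ topEigenvalue hA := by
  have hvv : 0 < v ⬝ᵥ v := by
    rw [dotProduct]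
    obtain ⟨j, hj⟩ : ∃ j, v j ≠ 0 := by
      by_contra hcon
      push Not at hcon
      exact hv (funext hcon)
    exact Finset.sum_pos' (fun i _ => mul_self_nonneg (v i)) ⟨j, Finset.mem_univ _, mul_self_pos.2 hj⟩
  have hR := dotProduct_mulVec_le hA v
  rw [h, dotProduct_smul, smul_eq_mul] at hR
  exact le_of_mul_le_mul_right hR hvv

/-- **`2δ - Λ ≤ μ`** for any real eigenpair of a symmetric matrix with nonnegative off-diagonal
entries and diagonal `≥ δ` (the argument of `two_mul_sub_topEigenvalue_le_eigenvalues` for an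
arbitrary eigenvector). [cite: DingZhou2009, §2.1, proof of Theorem 2.1] -/
theorem two_mul_sub_topEigenvalue_le_of_mulVec [Nonempty n] {A : Matrix n n ℝ} (hA : A.IsHermitian)
    (hA0 : ∀ i j, i ≠ j → 0 ≤ A i j) {δ : ℝ} (hdiag : ∀ i, δ ≤ A i i)
    {v : n → ℝ} {μ : ℝ} (hv : v ≠ 0) (h : A *ᵥ v = μ • v) : 2 * δ - topEigenvalue hA ≤ μ := by
  set a : n → ℝ := fun i => |v i| with ha
  have hvv : 0 < v ⬝ᵥ v := by
    rw [dotProduct]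
    obtain ⟨j, hj⟩ : ∃ j, v j ≠ 0 := by
      by_contra hcon
      push Not at hcon
      exact hv (funext hcon)
    exact Finset.sum_pos' (fun i _ => mul_self_nonneg (v i)) ⟨j, Finset.mem_univ _, mul_self_pos.2 hj⟩
  have haa : a ⬝ᵥ a = v ⬝ᵥ v := by rw [ha, dotProduct_abs_self]
  have hμ : v ⬝ᵥ (A *ᵥ v) = μ * (v ⬝ᵥ v) := by rw [h, dotProduct_smul, smul_eq_mul]
  have hN0 : ∀ i j, 0 ≤ (A - δ • (1 : Matrix n n ℝ)) i j := by
    intro i j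
    rw [Matrix.sub_apply, Matrix.smul_apply, one_apply, smul_eq_mul]
    by_cases hij : i = j
    · subst hij
      rw [if_pos rfl, mul_one, sub_nonneg]
      exact hdiag i
    · rw [if_neg hij, mul_zero, sub_zero]
      exact hA0 i j hij
  have h1 := abs_dotProduct_mulVec_le_dotProduct_abs hN0 v
  rw [dotProduct_sub_smul_one_mulVec, dotProduct_sub_smul_one_mulVec, haa, hμ] at h1
  have h2 : a ⬝ᵥ (A *ᵥ a) ≤ topEigenvalue hA * (v ⬝ᵥ v) := by
    have h := dotProduct_mulVec_le hA a
    rwa [haa] at h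
  have h4 := (abs_le.mp h1).1
  -- `μ (v⋅v) - δ (v⋅v) ≥ -(a A a - δ v⋅v) ≥ -(Λ - δ)(v⋅v)`
  have h5 : (2 * δ - topEigenvalue hA) * (v ⬝ᵥ v) ≤ μ * (v ⬝ᵥ v) := by nlinarith
  exact le_of_mul_le_mul_right h5 hvv

end Literature.LinearAlgebra.Matrix

namespace Literature.Probability.LatticeModels.SixVertex

/-! ## 2. The joint eigenbasis of `t(π/2)` and `T(0)` for `L = 2(ℓ+1)` -/

section Joint

variable (c : ℝ) (ℓ : ℕ)

/-- The balanced transfer matrix is symmetric (`a = b = 1`). [cite: DKLM2026SixVertexGFF, Lemma 57] -/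
theorem transfer_isSymm : (balancedTransferMatrix (G₂ := ZMod (2 * (ℓ + 1))) 1 1 c).IsSymm :=
  balancedTransferMatrix_isSymm 1 c

/-- `T(0)` is orthogonal. [cite: DKLM2026SixVertexGFF, Lemma 60] -/
theorem upShift_mul_transpose :
    upShiftMatrix (G₂ := ZMod (2 * (ℓ + 1))) * (upShiftMatrix (G₂ := ZMod (2 * (ℓ + 1))))ᵀ = 1 :=
  upShiftMatrix_mul_transpose

/-- `t(π/2) T(0) = T(0) t(π/2)`. [cite: DKLM2026SixVertexGFF, Lemma 60] -/
theorem transfer_mul_upShift :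
    balancedTransferMatrix (G₂ := ZMod (2 * (ℓ + 1))) 1 1 c * upShiftMatrix =
      upShiftMatrix * balancedTransferMatrix (G₂ := ZMod (2 * (ℓ + 1))) 1 1 c :=
  (upShiftMatrix_mul_balancedTransferMatrix 1 1 c).symm

/-- **The joint unitary `W`** of `t(π/2)` and `T(0)` (columns: the joint orthonormal eigenbasis
`(v_k)_k` of Lemma 60). [cite: DKLM2026SixVertexGFF, Lemma 60] -/
def transferJointUnitary :
    Matrix {κ : ZMod (2 * (ℓ + 1)) → Bool // IsBalancedCol κ}
      {κ : ZMod (2 * (ℓ + 1)) → Bool // IsBalancedCol κ} ℂ :=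
  jointUnitary (transfer_isSymm c ℓ) (upShift_mul_transpose ℓ) (transfer_mul_upShift c ℓ)

/-- **The eigenvalues `λ_k(π/2)` of `t(π/2)`** along the joint eigenbasis.
[cite: DKLM2026SixVertexGFF, Lemma 60] -/
def transferJointEigenvalue (k : {κ : ZMod (2 * (ℓ + 1)) → Bool // IsBalancedCol κ}) : ℝ :=
  jointEigenvalue (transfer_isSymm c ℓ) (upShift_mul_transpose ℓ) (transfer_mul_upShift c ℓ) k

/-- **The eigenvalues of `T(0)`** along the joint eigenbasis (the `Λ_k(0)` of Lemma 60, up to the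
transposed indexing convention). [cite: DKLM2026SixVertexGFF, Lemma 60] -/
def transferJointPhase (k : {κ : ZMod (2 * (ℓ + 1)) → Bool // IsBalancedCol κ}) : ℂ :=
  jointPhase (transfer_isSymm c ℓ) (upShift_mul_transpose ℓ) (transfer_mul_upShift c ℓ) k

/-- `W W⋆ = 1`. [cite: DKLM2026SixVertexGFF, Lemma 60] -/
theorem transferJointUnitary_mul_star :
    transferJointUnitary c ℓ * star (transferJointUnitary c ℓ) = 1 :=
  Matrix.mem_unitaryGroup_iff.mp (jointUnitary_mem_unitaryGroup _ _ _)

/-- `W⋆ W = 1`. [cite: DKLM2026SixVertexGFF, Lemma 60] -/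
theorem star_mul_transferJointUnitary :
    star (transferJointUnitary c ℓ) * transferJointUnitary c ℓ = 1 :=
  Matrix.mem_unitaryGroup_iff'.mp (jointUnitary_mem_unitaryGroup _ _ _)

/-- **`t(π/2)_ℂ W = W diag(λ)`.** [cite: DKLM2026SixVertexGFF, Lemma 60] -/
theorem cpx_transfer_mul_jointUnitary :
    cpx (balancedTransferMatrix (G₂ := ZMod (2 * (ℓ + 1))) 1 1 c) * transferJointUnitary c ℓ =
      transferJointUnitary c ℓ * diagonal fun k => ((transferJointEigenvalue c ℓ k : ℝ) : ℂ) :=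
  cpx_mul_jointUnitary _ _ _

/-- **`T(0)_ℂ W = W diag(ω)`.** [cite: DKLM2026SixVertexGFF, Lemma 60] -/
theorem cpx_upShift_mul_jointUnitary :
    cpx (upShiftMatrix (G₂ := ZMod (2 * (ℓ + 1)))) * transferJointUnitary c ℓ =
      transferJointUnitary c ℓ * diagonal (transferJointPhase c ℓ) :=
  cpxP_mul_jointUnitary _ _ _

/-- The `k`-th column of `W` is an eigenvector of `t(π/2)_ℂ` for `λ_k`. [cite: DKLM2026SixVertexGFF, Lemma 60] -/
theorem cpx_transfer_mulVec_col (k : {κ : ZMod (2 * (ℓ + 1)) → Bool // IsBalancedCol κ}) :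
    cpx (balancedTransferMatrix (G₂ := ZMod (2 * (ℓ + 1))) 1 1 c) *ᵥ
        (fun i => transferJointUnitary c ℓ i k) =
      ((transferJointEigenvalue c ℓ k : ℝ) : ℂ) • fun i => transferJointUnitary c ℓ i k :=
  cpx_mulVec_jointEigenvectorBasis _ _ _ k

/-- The `k`-th column of `W` is an eigenvector of `T(0)_ℂ` for `ω_k`. [cite: DKLM2026SixVertexGFF, Lemma 60] -/
theorem cpx_upShift_mulVec_col (k : {κ : ZMod (2 * (ℓ + 1)) → Bool // IsBalancedCol κ}) :
    cpx (upShiftMatrix (G₂ := ZMod (2 * (ℓ + 1)))) *ᵥ (fun i => transferJointUnitary c ℓ i k) =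
      transferJointPhase c ℓ k • fun i => transferJointUnitary c ℓ i k :=
  cpxP_mulVec_jointEigenvectorBasis _ _ _ k

/-- The columns of `W` are nonzero. [folklore] -/
theorem transferJointUnitary_col_ne_zero (k : {κ : ZMod (2 * (ℓ + 1)) → Bool // IsBalancedCol κ}) :
    (fun i => transferJointUnitary c ℓ i k) ≠ 0 :=
  jointEigenvectorBasis_ne_zero _ _ _ k

/-- **`|ω_k| = 1`.** [cite: DKLM2026SixVertexGFF, Lemma 60] -/
theorem norm_transferJointPhase (k : {κ : ZMod (2 * (ℓ + 1)) → Bool // IsBalancedCol κ}) :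
    ‖transferJointPhase c ℓ k‖ = 1 :=
  norm_jointPhase _ _ _ k

/-- `ω̄_k ω_k = 1`. [cite: DKLM2026SixVertexGFF, Lemma 60] -/
theorem conj_transferJointPhase_mul_self (k : {κ : ZMod (2 * (ℓ + 1)) → Bool // IsBalancedCol κ}) :
    (starRingEnd ℂ) (transferJointPhase c ℓ k) * transferJointPhase c ℓ k = 1 :=
  conj_jointPhase_mul_self _ _ _ k

/-- **`ω_k^L = 1`** (`T(0)^L = 1`, Lemma 60: the `Λ_k(0)` are `L`-th roots of unity).
[cite: DKLM2026SixVertexGFF, Lemma 60] -/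
theorem transferJointPhase_pow_card (k : {κ : ZMod (2 * (ℓ + 1)) → Bool // IsBalancedCol κ}) :
    transferJointPhase c ℓ k ^ (2 * (ℓ + 1)) = 1 := by
  have h := upShiftMatrix_pow_card (G₂ := ZMod (2 * (ℓ + 1)))
  rw [ZMod.card] at h
  exact jointPhase_pow_eq_one _ _ _ h k

end Joint

/-! ## 3. The simple top index and `Λ_0(0) = 1` -/

section Top

variable (c : ℝ) (hc : 0 < c) (ℓ : ℕ)

include hc

/-- **The Perron vector `v_0`**: a positive eigenvector of `t(π/2)` for the largest eigenvalue
`Λ` (Lemma 57). [cite: DKLM2026SixVertexGFF, Lemma 57] -/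
def perronVec : {κ : ZMod (2 * (ℓ + 1)) → Bool // IsBalancedCol κ} → ℝ :=
  Classical.choose (exists_pos_eigenvector_balancedTransferMatrix hc ℓ)

/-- `v_0 > 0`. [cite: DKLM2026SixVertexGFF, Lemma 57] -/
theorem perronVec_pos (i : {κ : ZMod (2 * (ℓ + 1)) → Bool // IsBalancedCol κ}) :
    0 < perronVec c hc ℓ i :=
  (Classical.choose_spec (exists_pos_eigenvector_balancedTransferMatrix hc ℓ)).1 i

/-- `t v_0 = Λ v_0`. [cite: DKLM2026SixVertexGFF, Lemma 57] -/
theorem mulVec_perronVec :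
    balancedTransferMatrix 1 1 c *ᵥ perronVec c hc ℓ =
      topEigenvalue (balancedTransferMatrix_isHermitian (G₂ := ZMod (2 * (ℓ + 1))) 1 c) •
        perronVec c hc ℓ :=
  (Classical.choose_spec (exists_pos_eigenvector_balancedTransferMatrix hc ℓ)).2

/-- **Every real eigenvector of `t(π/2)` for `Λ` is a multiple of `v_0`** (simplicity, Lemma 57 /
Remark 58, through Perron's theorem for a positive power of `t`).
[cite: DKLM2026SixVertexGFF, Lemma 57 and Remark 58] -/
theorem exists_eq_smul_perronVec {w : {κ : ZMod (2 * (ℓ + 1)) → Bool // IsBalancedCol κ} → ℝ}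
    (hw : balancedTransferMatrix 1 1 c *ᵥ w =
      topEigenvalue (balancedTransferMatrix_isHermitian (G₂ := ZMod (2 * (ℓ + 1))) 1 c) • w) :
    ∃ a : ℝ, w = a • perronVec c hc ℓ := by
  set hA := balancedTransferMatrix_isHermitian (G₂ := ZMod (2 * (ℓ + 1))) 1 c
  obtain ⟨m, hm⟩ := exists_balancedTransferMatrix_pow_pos hc (2 * ℓ + 1) (by omega)
  obtain ⟨δ, hδ, hdiag⟩ := exists_balancedTransferMatrix_diag_ge (G₂ := ZMod (2 * (ℓ + 1))) c hc
  have hBtop := topEigenvalue_pow_eq hA (balancedTransferMatrix_offdiag_nonneg c hc) hδ hdiag m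
  have hBv : balancedTransferMatrix 1 1 c ^ m *ᵥ perronVec c hc ℓ =
      topEigenvalue (hA.pow m) • perronVec c hc ℓ := by
    rw [hBtop]
    exact pow_mulVec_of_mulVec_eq_smul (mulVec_perronVec c hc ℓ) m
  have hBw : balancedTransferMatrix 1 1 c ^ m *ᵥ w = topEigenvalue (hA.pow m) • w := by
    rw [hBtop]
    exact pow_mulVec_of_mulVec_eq_smul hw m
  exact eq_smul_of_mulVec_eq_topEigenvalue (hA.pow m) hm (perronVec_pos c hc ℓ) hBv hBw

/-- **A complex eigenvector of `t(π/2)` for `Λ` is a complex multiple of `v_0`.**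
[cite: DKLM2026SixVertexGFF, Lemma 57 and Remark 58] -/
theorem exists_eq_smul_perronVec_of_cpx {w : {κ : ZMod (2 * (ℓ + 1)) → Bool // IsBalancedCol κ} → ℂ}
    (hw : cpx (balancedTransferMatrix (G₂ := ZMod (2 * (ℓ + 1))) 1 1 c) *ᵥ w =
      ((topEigenvalue (balancedTransferMatrix_isHermitian (G₂ := ZMod (2 * (ℓ + 1))) 1 c) : ℝ) : ℂ) • w) :
    ∃ z : ℂ, w = z • fun i => ((perronVec c hc ℓ i : ℝ) : ℂ) := by
  obtain ⟨a, ha⟩ := exists_eq_smul_perronVec c hc ℓ (mulVec_re_of_cpx_mulVec hw)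
  obtain ⟨b, hb⟩ := exists_eq_smul_perronVec c hc ℓ (mulVec_im_of_cpx_mulVec hw)
  refine ⟨(a : ℂ) + Complex.I * (b : ℂ), ?_⟩
  rw [eq_re_add_I_im w]
  funext i
  have hai := congrFun ha i
  have hbi := congrFun hb i
  simp only [Pi.smul_apply, smul_eq_mul] at hai hbi
  simp only [Pi.add_apply, Pi.smul_apply, smul_eq_mul, hai, hbi, Complex.ofReal_mul]
  ring

/-- **Uniqueness of the top index in the joint eigenbasis**: at most one `k` has `λ_k = Λ`.
[cite: DKLM2026SixVertexGFF, Lemma 57 and Remark 58] -/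
theorem transferJointEigenvalue_eq_top_unique
    {k k' : {κ : ZMod (2 * (ℓ + 1)) → Bool // IsBalancedCol κ}}
    (hk : transferJointEigenvalue c ℓ k =
      topEigenvalue (balancedTransferMatrix_isHermitian (G₂ := ZMod (2 * (ℓ + 1))) 1 c))
    (hk' : transferJointEigenvalue c ℓ k' =
      topEigenvalue (balancedTransferMatrix_isHermitian (G₂ := ZMod (2 * (ℓ + 1))) 1 c)) :
    k = k' := by
  by_contra hne
  have h1 := cpx_transfer_mulVec_col c ℓ k
  have h2 := cpx_transfer_mulVec_col c ℓ k'
  rw [hk] at h1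
  rw [hk'] at h2
  obtain ⟨z, hz⟩ := exists_eq_smul_perronVec_of_cpx c hc ℓ h1
  obtain ⟨z', hz'⟩ := exists_eq_smul_perronVec_of_cpx c hc ℓ h2
  -- orthogonality of the columns `k ≠ k'` of the unitary `W`: `(W⋆ W) k k' = 0`
  have horth : (star (transferJointUnitary c ℓ) * transferJointUnitary c ℓ) k k' = 0 := by
    rw [star_mul_transferJointUnitary, Matrix.one_apply_ne hne]
  rw [Matrix.mul_apply] at horth
  simp only [Matrix.star_apply] at horth
  have hcol : ∀ i, transferJointUnitary c ℓ i k = z * (perronVec c hc ℓ i : ℂ) := fun i => by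
    have := congrFun hz i; simpa using this
  have hcol' : ∀ i, transferJointUnitary c ℓ i k' = z' * (perronVec c hc ℓ i : ℂ) := fun i => by
    have := congrFun hz' i; simpa using this
  simp only [hcol, hcol', star_mul', Complex.star_def, Complex.conj_ofReal] at horth
  have hsum : ∑ i, (starRingEnd ℂ) z * (perronVec c hc ℓ i : ℂ) * (z' * (perronVec c hc ℓ i : ℂ)) =
      (starRingEnd ℂ) z * z' * ∑ i, ((perronVec c hc ℓ i * perronVec c hc ℓ i : ℝ) : ℂ) := by
    rw [Finset.mul_sum]
    refine Finset.sum_congr rfl fun i _ => ?_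
    push_cast
    ring
  rw [hsum] at horth
  have hpos : 0 < ∑ i, perronVec c hc ℓ i * perronVec c hc ℓ i :=
    Finset.sum_pos (fun i _ => mul_pos (perronVec_pos c hc ℓ i) (perronVec_pos c hc ℓ i))
      Finset.univ_nonempty
  have hne0 : (∑ i, ((perronVec c hc ℓ i * perronVec c hc ℓ i : ℝ) : ℂ)) ≠ 0 := by
    rw [← Complex.ofReal_sum]
    exact_mod_cast hpos.ne'
  have hzz : (starRingEnd ℂ) z * z' = 0 := (mul_eq_zero.mp horth).resolve_right hne0
  rcases mul_eq_zero.mp hzz with h0 | h0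
  · have hz0 : z = 0 := by simpa using h0
    apply transferJointUnitary_col_ne_zero c ℓ k
    rw [hz, hz0, zero_smul]
  · apply transferJointUnitary_col_ne_zero c ℓ k'
    rw [hz', h0, zero_smul]

/-- **Existence of the top index**: some `k` has `λ_k = Λ` (the Perron vector lies in the span of
the joint eigenvectors with eigenvalue `Λ`). [cite: DKLM2026SixVertexGFF, Lemma 57 and Lemma 60] -/
theorem exists_transferJointEigenvalue_eq_top :
    ∃ k : {κ : ZMod (2 * (ℓ + 1)) → Bool // IsBalancedCol κ}, transferJointEigenvalue c ℓ k =
      topEigenvalue (balancedTransferMatrix_isHermitian (G₂ := ZMod (2 * (ℓ + 1))) 1 c) := by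
  by_contra hnone
  push Not at hnone
  have hsymm : (cpx (balancedTransferMatrix (G₂ := ZMod (2 * (ℓ + 1))) 1 1 c)).IsHermitian :=
    isHermitian_cpx (transfer_isSymm c ℓ)
  -- the real Perron vector as a complex `Λ`-eigenvector
  have hAv : cpx (balancedTransferMatrix (G₂ := ZMod (2 * (ℓ + 1))) 1 1 c) *ᵥ
      (fun i => ((perronVec c hc ℓ i : ℝ) : ℂ)) =
      ((topEigenvalue (balancedTransferMatrix_isHermitian (G₂ := ZMod (2 * (ℓ + 1))) 1 c) : ℝ) : ℂ) •
        fun i => ((perronVec c hc ℓ i : ℝ) : ℂ) := by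
    rw [cpx_mulVec_ofReal, mulVec_perronVec c hc ℓ]
    funext i
    simp
  -- `W⋆ A = D W⋆` (`A` Hermitian with real eigenvalues)
  have hrow : star (transferJointUnitary c ℓ) * cpx (balancedTransferMatrix (G₂ := ZMod (2 * (ℓ + 1))) 1 1 c) =
      diagonal (fun k => ((transferJointEigenvalue c ℓ k : ℝ) : ℂ)) * star (transferJointUnitary c ℓ) := by
    rw [Matrix.star_eq_conjTranspose]
    have h := congrArg Matrix.conjTranspose (cpx_transfer_mul_jointUnitary c ℓ)
    rw [Matrix.conjTranspose_mul, Matrix.conjTranspose_mul, hsymm.eq, Matrix.diagonal_conjTranspose] at h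
    rw [h]
    congr 1
    ext i j
    simp [Matrix.diagonal_apply]
  -- each coefficient `(W⋆ v)_k` vanishes: `(Λ - λ_k) (W⋆ v)_k = 0` with `λ_k ≠ Λ`
  have hcols : ∀ k, (star (transferJointUnitary c ℓ) *ᵥ fun i => ((perronVec c hc ℓ i : ℝ) : ℂ)) k = 0 := by
    intro k
    have e1 : (star (transferJointUnitary c ℓ) *ᵥ (cpx (balancedTransferMatrix (G₂ := ZMod (2 * (ℓ + 1))) 1 1 c) *ᵥ
        fun i => ((perronVec c hc ℓ i : ℝ) : ℂ))) k =
        ((topEigenvalue (balancedTransferMatrix_isHermitian (G₂ := ZMod (2 * (ℓ + 1))) 1 c) : ℝ) : ℂ) *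
          (star (transferJointUnitary c ℓ) *ᵥ fun i => ((perronVec c hc ℓ i : ℝ) : ℂ)) k := by
      rw [hAv, mulVec_smul, Pi.smul_apply, smul_eq_mul]
    have e2 : (star (transferJointUnitary c ℓ) *ᵥ (cpx (balancedTransferMatrix (G₂ := ZMod (2 * (ℓ + 1))) 1 1 c) *ᵥ
        fun i => ((perronVec c hc ℓ i : ℝ) : ℂ))) k =
        ((transferJointEigenvalue c ℓ k : ℝ) : ℂ) *
          (star (transferJointUnitary c ℓ) *ᵥ fun i => ((perronVec c hc ℓ i : ℝ) : ℂ)) k := by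
      rw [mulVec_mulVec, hrow, ← mulVec_mulVec, mulVec_diagonal]
    have h3 : (((topEigenvalue (balancedTransferMatrix_isHermitian (G₂ := ZMod (2 * (ℓ + 1))) 1 c) : ℝ) : ℂ) -
        ((transferJointEigenvalue c ℓ k : ℝ) : ℂ)) *
        (star (transferJointUnitary c ℓ) *ᵥ fun i => ((perronVec c hc ℓ i : ℝ) : ℂ)) k = 0 := by
      rw [sub_mul, ← e1, ← e2, sub_self]
    rcases mul_eq_zero.mp h3 with h4 | h4
    · exact absurd (by exact_mod_cast (sub_eq_zero.mp h4).symm) (hnone k)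
    · exact h4
  have hzero : (star (transferJointUnitary c ℓ) *ᵥ fun i => ((perronVec c hc ℓ i : ℝ) : ℂ)) = 0 :=
    funext hcols
  have hv : (fun i => ((perronVec c hc ℓ i : ℝ) : ℂ)) = 0 := by
    have h := congrArg (fun x => transferJointUnitary c ℓ *ᵥ x) hzero
    simp only [mulVec_mulVec, mulVec_zero] at h
    rwa [transferJointUnitary_mul_star, one_mulVec] at h
  have h0 := congrFun hv (Classical.arbitrary _)
  simp only [Pi.zero_apply, Complex.ofReal_eq_zero] at h0
  exact (perronVec_pos c hc ℓ _).ne' h0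

/-- **The top index `k₀`** of the joint eigenbasis: the unique `k` with `λ_k = Λ` (the `v_0` slot).
[cite: DKLM2026SixVertexGFF, Lemma 57 and Lemma 60] -/
def topIdx : {κ : ZMod (2 * (ℓ + 1)) → Bool // IsBalancedCol κ} :=
  Classical.choose (exists_transferJointEigenvalue_eq_top c hc ℓ)

/-- `λ_{k₀} = Λ`. [cite: DKLM2026SixVertexGFF, Lemma 57] -/
theorem transferJointEigenvalue_topIdx :
    transferJointEigenvalue c ℓ (topIdx c hc ℓ) =
      topEigenvalue (balancedTransferMatrix_isHermitian (G₂ := ZMod (2 * (ℓ + 1))) 1 c) :=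
  Classical.choose_spec (exists_transferJointEigenvalue_eq_top c hc ℓ)

/-- `λ_k = Λ ↔ k = k₀`. [cite: DKLM2026SixVertexGFF, Lemma 57] -/
theorem transferJointEigenvalue_eq_top_iff (k : {κ : ZMod (2 * (ℓ + 1)) → Bool // IsBalancedCol κ}) :
    transferJointEigenvalue c ℓ k =
        topEigenvalue (balancedTransferMatrix_isHermitian (G₂ := ZMod (2 * (ℓ + 1))) 1 c) ↔
      k = topIdx c hc ℓ :=
  ⟨fun h => transferJointEigenvalue_eq_top_unique c hc ℓ h (transferJointEigenvalue_topIdx c hc ℓ),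
    fun h => h ▸ transferJointEigenvalue_topIdx c hc ℓ⟩

/-- **`-Λ < λ_k ≤ Λ`** for every joint eigenvalue (`-Λ` excluded by the positive diagonal).
[cite: DKLM2026SixVertexGFF, Remark 58] -/
theorem transferJointEigenvalue_bounds (k : {κ : ZMod (2 * (ℓ + 1)) → Bool // IsBalancedCol κ}) :
    -topEigenvalue (balancedTransferMatrix_isHermitian (G₂ := ZMod (2 * (ℓ + 1))) 1 c) <
        transferJointEigenvalue c ℓ k ∧
      transferJointEigenvalue c ℓ k ≤
        topEigenvalue (balancedTransferMatrix_isHermitian (G₂ := ZMod (2 * (ℓ + 1))) 1 c) := by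
  set hA := balancedTransferMatrix_isHermitian (G₂ := ZMod (2 * (ℓ + 1))) 1 c
  obtain ⟨δ, hδ, hdiag⟩ := exists_balancedTransferMatrix_diag_ge (G₂ := ZMod (2 * (ℓ + 1))) c hc
  have hcol := cpx_transfer_mulVec_col c ℓ k
  -- a nonzero real eigenvector among the real and imaginary parts of the column
  have hre := mulVec_re_of_cpx_mulVec hcol
  have him := mulVec_im_of_cpx_mulVec hcol
  have hnz : (fun i => (transferJointUnitary c ℓ i k).re) ≠ 0 ∨
      (fun i => (transferJointUnitary c ℓ i k).im) ≠ 0 := by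
    by_contra hcon
    push Not at hcon
    apply transferJointUnitary_col_ne_zero c ℓ k
    funext i
    have h1 := congrFun hcon.1 i
    have h2 := congrFun hcon.2 i
    simp only [Pi.zero_apply] at h1 h2 ⊢
    exact Complex.ext h1 h2
  have hΛ := topEigenvalue_pos_of_diag hA hδ hdiag
  rcases hnz with hv | hv
  · refine ⟨?_, eigenvalue_le_topEigenvalue_of_mulVec hA hv hre⟩
    have := two_mul_sub_topEigenvalue_le_of_mulVec hA (balancedTransferMatrix_offdiag_nonneg c hc)
      hdiag hv hre
    linarith
  · refine ⟨?_, eigenvalue_le_topEigenvalue_of_mulVec hA hv him⟩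
    have := two_mul_sub_topEigenvalue_le_of_mulVec hA (balancedTransferMatrix_offdiag_nonneg c hc)
      hdiag hv him
    linarith

/-- **`|λ_k| < Λ` off the top index** (`|Λ_k(π/2)| < 1` for `k > 0`).
[cite: DKLM2026SixVertexGFF, Lemma 57 and proof of Theorem 23 ("`|Λ_k(π/2)| < 1` for every `k > 0`")] -/
theorem abs_transferJointEigenvalue_lt_top {k : {κ : ZMod (2 * (ℓ + 1)) → Bool // IsBalancedCol κ}}
    (hk : k ≠ topIdx c hc ℓ) :
    |transferJointEigenvalue c ℓ k| <
      topEigenvalue (balancedTransferMatrix_isHermitian (G₂ := ZMod (2 * (ℓ + 1))) 1 c) := by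
  obtain ⟨h1, h2⟩ := transferJointEigenvalue_bounds c hc ℓ k
  refine abs_lt.2 ⟨h1, lt_of_le_of_ne h2 fun h => hk ?_⟩
  exact (transferJointEigenvalue_eq_top_iff c hc ℓ k).1 h

/-- The top column of `W` is a complex multiple of `v_0`. [cite: DKLM2026SixVertexGFF, Lemma 60] -/
theorem exists_topCol_eq_smul_perronVec :
    ∃ z : ℂ, z ≠ 0 ∧ (fun i => transferJointUnitary c ℓ i (topIdx c hc ℓ)) =
      z • fun i => ((perronVec c hc ℓ i : ℝ) : ℂ) := by
  have h1 := cpx_transfer_mulVec_col c ℓ (topIdx c hc ℓ)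
  rw [transferJointEigenvalue_topIdx] at h1
  obtain ⟨z, hz⟩ := exists_eq_smul_perronVec_of_cpx c hc ℓ h1
  refine ⟨z, fun hz0 => ?_, hz⟩
  apply transferJointUnitary_col_ne_zero c ℓ (topIdx c hc ℓ)
  rw [hz, hz0, zero_smul]

/-- **Lemma 60: `Λ_0(0) = 1`** — the phase of the top index is `1` (the Perron vector is
positive and `T(0)` is a permutation matrix). [cite: DKLM2026SixVertexGFF, Lemma 60] -/
theorem transferJointPhase_topIdx : transferJointPhase c ℓ (topIdx c hc ℓ) = 1 := by
  obtain ⟨z, hz0, hz⟩ := exists_topCol_eq_smul_perronVec c hc ℓ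
  have hP := cpx_upShift_mulVec_col c ℓ (topIdx c hc ℓ)
  rw [hz, mulVec_smul] at hP
  -- `T(0) v_0 = ω v_0` with `v_0 > 0` real
  have hPv : cpx (upShiftMatrix (G₂ := ZMod (2 * (ℓ + 1)))) *ᵥ (fun i => ((perronVec c hc ℓ i : ℝ) : ℂ)) =
      transferJointPhase c ℓ (topIdx c hc ℓ) • fun i => ((perronVec c hc ℓ i : ℝ) : ℂ) := by
    have h := congrArg (fun x => z⁻¹ • x) hP
    simp only [smul_smul, inv_mul_cancel₀ hz0, one_smul] at h
    rw [h, show z⁻¹ * (transferJointPhase c ℓ (topIdx c hc ℓ) * z) =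
      transferJointPhase c ℓ (topIdx c hc ℓ) by field_simp]
  -- evaluate at some row `κ`: `(T(0) v_0)_κ = v_0(κ↑)` is a positive real
  let κ : {κ : ZMod (2 * (ℓ + 1)) → Bool // IsBalancedCol κ} := Classical.arbitrary _
  have hrow := congrFun hPv κ
  rw [cpx_mulVec_ofReal] at hrow
  simp only [Pi.smul_apply, smul_eq_mul] at hrow
  have hreal : (upShiftMatrix (G₂ := ZMod (2 * (ℓ + 1))) *ᵥ perronVec c hc ℓ) κ =
      perronVec c hc ℓ (shiftBalEquiv κ) := by
    unfold upShiftMatrix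
    rw [PEquiv.toMatrix_toPEquiv_mulVec]
    rfl
  rw [hreal] at hrow
  have hvpos : (0 : ℝ) < perronVec c hc ℓ κ := perronVec_pos c hc ℓ κ
  have hω : transferJointPhase c ℓ (topIdx c hc ℓ) =
      ((perronVec c hc ℓ (shiftBalEquiv κ) / perronVec c hc ℓ κ : ℝ) : ℂ) := by
    rw [Complex.ofReal_div, eq_div_iff (by exact_mod_cast hvpos.ne'), ← hrow]
  -- a positive real of modulus one is `1`
  have hnorm := norm_transferJointPhase c ℓ (topIdx c hc ℓ)
  rw [hω, Complex.norm_real, Real.norm_eq_abs,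
    abs_of_pos (div_pos (perronVec_pos c hc ℓ _) hvpos)] at hnorm
  rw [hω, hnorm, Complex.ofReal_one]

end Top


/-! ## 4. Theorem 23, Step 1: vertical-arrow correlations in the joint eigenbasis -/

section StepOne

variable (c : ℝ) (hc : 0 < c) (ℓ : ℕ)

/-- Conjugating by the joint unitary: `W⋆ (M N) W = (W⋆ M W)(W⋆ N W)`. [folklore] -/
theorem conj_mul (M N : Matrix {κ : ZMod (2 * (ℓ + 1)) → Bool // IsBalancedCol κ}
    {κ : ZMod (2 * (ℓ + 1)) → Bool // IsBalancedCol κ} ℂ) :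
    star (transferJointUnitary c ℓ) * (M * N) * transferJointUnitary c ℓ =
      star (transferJointUnitary c ℓ) * M * transferJointUnitary c ℓ *
        (star (transferJointUnitary c ℓ) * N * transferJointUnitary c ℓ) := by
  have h : star (transferJointUnitary c ℓ) * M * transferJointUnitary c ℓ *
      (star (transferJointUnitary c ℓ) * N * transferJointUnitary c ℓ) =
      star (transferJointUnitary c ℓ) * M * (transferJointUnitary c ℓ * star (transferJointUnitary c ℓ)) *
        N * transferJointUnitary c ℓ := by
    simp only [Matrix.mul_assoc]
  rw [h, transferJointUnitary_mul_star, Matrix.mul_one, Matrix.mul_assoc _ M N]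

/-- `W⋆ T(0)_ℂ W = diag(ω)`. [cite: DKLM2026SixVertexGFF, Lemma 60] -/
theorem conj_cpx_upShift :
    star (transferJointUnitary c ℓ) * cpx (upShiftMatrix (G₂ := ZMod (2 * (ℓ + 1)))) *
        transferJointUnitary c ℓ = diagonal (transferJointPhase c ℓ) := by
  rw [Matrix.mul_assoc, cpx_upShift_mul_jointUnitary, ← Matrix.mul_assoc, star_mul_transferJointUnitary,
    Matrix.one_mul]

/-- `W⋆ (T(0)ᵀ)_ℂ W = diag(ω̄)`. [cite: DKLM2026SixVertexGFF, Lemma 60] -/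
theorem conj_cpx_upShift_transpose :
    star (transferJointUnitary c ℓ) * cpx (upShiftMatrix (G₂ := ZMod (2 * (ℓ + 1))))ᵀ *
        transferJointUnitary c ℓ = diagonal (star (transferJointPhase c ℓ)) := by
  have h := congrArg Matrix.conjTranspose (conj_cpx_upShift c ℓ)
  rw [Matrix.conjTranspose_mul, Matrix.conjTranspose_mul, cpx_conjTranspose, Matrix.diagonal_conjTranspose,
    ← Matrix.star_eq_conjTranspose, ← Matrix.star_eq_conjTranspose, star_star, ← Matrix.mul_assoc] at h
  exact h

/-- Powers of conjugated matrices: `(W⋆ M W)^m = W⋆ M^m W`. [folklore] -/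
theorem conj_pow (M : Matrix {κ : ZMod (2 * (ℓ + 1)) → Bool // IsBalancedCol κ}
    {κ : ZMod (2 * (ℓ + 1)) → Bool // IsBalancedCol κ} ℂ) (m : ℕ) :
    star (transferJointUnitary c ℓ) * M ^ m * transferJointUnitary c ℓ =
      (star (transferJointUnitary c ℓ) * M * transferJointUnitary c ℓ) ^ m := by
  induction m with
  | zero => rw [pow_zero, pow_zero, Matrix.mul_one, star_mul_transferJointUnitary]
  | succ m ih => rw [pow_succ, conj_mul, ih, ← pow_succ]

/-- **`s_m = (T(0)ᵀ)^m s_0 T(0)^m`** for the vertical-arrow operators (iterating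
`arrowMatrix_sub_one`). [cite: DKLM2026SixVertexGFF, Part III §3 ("`s_j = T(0)^j s_0 T(0)^{-j}`")] -/
theorem arrowMatrix_natCast (m : ℕ) :
    arrowMatrix (G₂ := ZMod (2 * (ℓ + 1))) c (m : ZMod (2 * (ℓ + 1))) =
      (upShiftMatrix (G₂ := ZMod (2 * (ℓ + 1))))ᵀ ^ m * arrowMatrix c 0 *
        upShiftMatrix (G₂ := ZMod (2 * (ℓ + 1))) ^ m := by
  induction m with
  | zero => simp
  | succ m ih =>
    have h := arrowMatrix_sub_one (G₂ := ZMod (2 * (ℓ + 1))) c ((m + 1 : ℕ) : ZMod (2 * (ℓ + 1)))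
    rw [show ((m + 1 : ℕ) : ZMod (2 * (ℓ + 1))) - 1 = (m : ZMod (2 * (ℓ + 1))) by push_cast; ring] at h
    -- `s_{m+1} = T0ᵀ s_m T0`
    have h2 : arrowMatrix (G₂ := ZMod (2 * (ℓ + 1))) c ((m + 1 : ℕ) : ZMod (2 * (ℓ + 1))) =
        (upShiftMatrix (G₂ := ZMod (2 * (ℓ + 1))))ᵀ * arrowMatrix c (m : ZMod (2 * (ℓ + 1))) *
          upShiftMatrix (G₂ := ZMod (2 * (ℓ + 1))) := by
      rw [h]
      have e : (upShiftMatrix (G₂ := ZMod (2 * (ℓ + 1))))ᵀ *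
          (upShiftMatrix * arrowMatrix c ((m + 1 : ℕ) : ZMod (2 * (ℓ + 1))) * upShiftMatrixᵀ) * upShiftMatrix =
          (upShiftMatrixᵀ * upShiftMatrix) * arrowMatrix c ((m + 1 : ℕ) : ZMod (2 * (ℓ + 1))) *
            (upShiftMatrixᵀ * upShiftMatrix) := by
        simp only [Matrix.mul_assoc]
      rw [e, upShiftMatrix_transpose_mul, Matrix.one_mul, Matrix.mul_one]
    rw [h2, ih,
      show (upShiftMatrix (G₂ := ZMod (2 * (ℓ + 1))))ᵀ ^ (m + 1) =
        (upShiftMatrix (G₂ := ZMod (2 * (ℓ + 1))))ᵀ * (upShiftMatrix (G₂ := ZMod (2 * (ℓ + 1))))ᵀ ^ m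
        from pow_succ' _ _,
      show upShiftMatrix (G₂ := ZMod (2 * (ℓ + 1))) ^ (m + 1) =
        upShiftMatrix (G₂ := ZMod (2 * (ℓ + 1))) ^ m * upShiftMatrix (G₂ := ZMod (2 * (ℓ + 1)))
        from pow_succ _ _]
    simp only [Matrix.mul_assoc]

/-- **The matrix elements of `s_0` in the joint eigenbasis from the top vector**:
`m_k := (W⋆ (s_0)_ℂ W)_{k₀ k} = v_0† … ` — the `v_k† S v_0` of the source up to normalisation
and conjugation. [cite: DKLM2026SixVertexGFF, proof of Theorem 23 (def. of `μ_L`)] -/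
def topArrowCoeff (k : {κ : ZMod (2 * (ℓ + 1)) → Bool // IsBalancedCol κ}) : ℂ :=
  (star (transferJointUnitary c ℓ) * cpx (arrowMatrix (G₂ := ZMod (2 * (ℓ + 1))) c 0) *
    transferJointUnitary c ℓ) (topIdx c hc ℓ) k

/-- Entries of `W⋆ (s_m)_ℂ W` from the top row: `(W⋆ s_m W)_{k₀ k} = m_k ω_k^m` (using `ω_{k₀} = 1`).
[cite: DKLM2026SixVertexGFF, proof of Theorem 23, Step 1] -/
theorem conj_arrowMatrix_top_apply (m : ℕ) (k : {κ : ZMod (2 * (ℓ + 1)) → Bool // IsBalancedCol κ}) :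
    (star (transferJointUnitary c ℓ) * cpx (arrowMatrix (G₂ := ZMod (2 * (ℓ + 1))) c (m : ZMod (2 * (ℓ + 1)))) *
        transferJointUnitary c ℓ) (topIdx c hc ℓ) k =
      topArrowCoeff c hc ℓ k * transferJointPhase c ℓ k ^ m := by
  rw [arrowMatrix_natCast, cpx_mul, cpx_mul, conj_mul, conj_mul,
    show cpx ((upShiftMatrix (G₂ := ZMod (2 * (ℓ + 1))))ᵀ ^ m) = cpx (upShiftMatrix (G₂ := ZMod (2 * (ℓ + 1))))ᵀ ^ m
      from Matrix.map_pow _ _ _,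
    show cpx (upShiftMatrix (G₂ := ZMod (2 * (ℓ + 1))) ^ m) = cpx (upShiftMatrix (G₂ := ZMod (2 * (ℓ + 1)))) ^ m
      from Matrix.map_pow _ _ _,
    conj_pow, conj_pow, conj_cpx_upShift, conj_cpx_upShift_transpose, diagonal_pow, diagonal_pow,
    Matrix.mul_diagonal, Matrix.diagonal_mul, Pi.pow_apply, Pi.pow_apply, Pi.star_apply,
    transferJointPhase_topIdx, star_one, one_pow, one_mul]
  rfl

/-- Entries into the top column: `(W⋆ s_m W)_{k k₀} = ω̄_k^m (W⋆ s_0 W)_{k k₀}`.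
[cite: DKLM2026SixVertexGFF, proof of Theorem 23, Step 1] -/
theorem conj_arrowMatrix_apply_top (m : ℕ) (k : {κ : ZMod (2 * (ℓ + 1)) → Bool // IsBalancedCol κ}) :
    (star (transferJointUnitary c ℓ) * cpx (arrowMatrix (G₂ := ZMod (2 * (ℓ + 1))) c (m : ZMod (2 * (ℓ + 1)))) *
        transferJointUnitary c ℓ) k (topIdx c hc ℓ) =
      star (transferJointPhase c ℓ k) ^ m *
        (star (transferJointUnitary c ℓ) * cpx (arrowMatrix (G₂ := ZMod (2 * (ℓ + 1))) c 0) *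
          transferJointUnitary c ℓ) k (topIdx c hc ℓ) := by
  rw [arrowMatrix_natCast, cpx_mul, cpx_mul, conj_mul, conj_mul,
    show cpx ((upShiftMatrix (G₂ := ZMod (2 * (ℓ + 1))))ᵀ ^ m) = cpx (upShiftMatrix (G₂ := ZMod (2 * (ℓ + 1))))ᵀ ^ m
      from Matrix.map_pow _ _ _,
    show cpx (upShiftMatrix (G₂ := ZMod (2 * (ℓ + 1))) ^ m) = cpx (upShiftMatrix (G₂ := ZMod (2 * (ℓ + 1)))) ^ m
      from Matrix.map_pow _ _ _,
    conj_pow, conj_pow, conj_cpx_upShift, conj_cpx_upShift_transpose, diagonal_pow, diagonal_pow,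
    Matrix.mul_diagonal, Matrix.diagonal_mul, Pi.pow_apply, Pi.pow_apply, Pi.star_apply,
    transferJointPhase_topIdx, one_pow, mul_one]

/-- **Anti-Hermitian symmetry of `W⋆ (s_0)_ℂ W`** (`s_0ᵀ = -s_0`, Lemma 61):
`(W⋆ s_0 W)_{k k₀} = -conj (m_k)`. [cite: DKLM2026SixVertexGFF, Lemma 61 and proof of Theorem 23, Step 1] -/
theorem conj_arrowMatrix_zero_apply_top (k : {κ : ZMod (2 * (ℓ + 1)) → Bool // IsBalancedCol κ}) :
    (star (transferJointUnitary c ℓ) * cpx (arrowMatrix (G₂ := ZMod (2 * (ℓ + 1))) c 0) *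
        transferJointUnitary c ℓ) k (topIdx c hc ℓ) = -(starRingEnd ℂ) (topArrowCoeff c hc ℓ k) := by
  have hanti : (star (transferJointUnitary c ℓ) * cpx (arrowMatrix (G₂ := ZMod (2 * (ℓ + 1))) c 0) *
      transferJointUnitary c ℓ)ᴴ =
      -(star (transferJointUnitary c ℓ) * cpx (arrowMatrix (G₂ := ZMod (2 * (ℓ + 1))) c 0) *
        transferJointUnitary c ℓ) := by
    rw [Matrix.conjTranspose_mul, Matrix.conjTranspose_mul, cpx_conjTranspose, arrowMatrix_transpose,
      ← Matrix.star_eq_conjTranspose, ← Matrix.star_eq_conjTranspose, star_star,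
      show cpx (-arrowMatrix (G₂ := ZMod (2 * (ℓ + 1))) c 0) = -cpx (arrowMatrix c 0) by
        ext i j; simp, Matrix.neg_mul, Matrix.mul_neg, Matrix.mul_assoc]
  have h := congrFun (congrFun hanti k) (topIdx c hc ℓ)
  rw [Matrix.conjTranspose_apply, Matrix.neg_apply, Complex.star_def] at h
  unfold topArrowCoeff
  rw [h, neg_neg]

/-- A real antisymmetric quadratic form vanishes on real vectors. [folklore] -/
theorem dotProduct_mulVec_eq_zero_of_antisymm {m : Type*} [Fintype m] {S : Matrix m m ℝ} (hS : Sᵀ = -S)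
    (v : m → ℝ) : v ⬝ᵥ (S *ᵥ v) = 0 := by
  have h : v ⬝ᵥ (S *ᵥ v) = -(v ⬝ᵥ (S *ᵥ v)) := by
    conv_lhs => rw [Matrix.dotProduct_mulVec, ← Matrix.mulVec_transpose, hS, Matrix.neg_mulVec, dotProduct_comm,
      dotProduct_neg]
  linarith

/-- **The top coefficient vanishes**: `m_{k₀} = 0` (`v_0† S v_0 = 0`, Lemma 61: the top column of
`W` is a complex multiple of the real positive `v_0`, and `s_0` is real antisymmetric).
[cite: DKLM2026SixVertexGFF, Lemma 61] -/
theorem topArrowCoeff_topIdx : topArrowCoeff c hc ℓ (topIdx c hc ℓ) = 0 := by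
  obtain ⟨z, -, hz⟩ := exists_topCol_eq_smul_perronVec c hc ℓ
  unfold topArrowCoeff
  rw [Matrix.mul_assoc, Matrix.mul_apply]
  simp only [Matrix.star_apply]
  have hcol : ∀ i, transferJointUnitary c ℓ i (topIdx c hc ℓ) = z * ((perronVec c hc ℓ i : ℝ) : ℂ) :=
    fun i => by have := congrFun hz i; simpa using this
  -- `∑_a conj(z v_a) (S (z v))_a = conj z * z * vᵀ S v = 0`
  have hinner : ∀ a, (cpx (arrowMatrix (G₂ := ZMod (2 * (ℓ + 1))) c 0) * transferJointUnitary c ℓ) a (topIdx c hc ℓ) =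
      z * (((arrowMatrix (G₂ := ZMod (2 * (ℓ + 1))) c 0 *ᵥ perronVec c hc ℓ) a : ℝ) : ℂ) := by
    intro a
    rw [Matrix.mul_apply]
    simp only [hcol, cpx_apply, Matrix.mulVec, dotProduct, Complex.ofReal_sum, Complex.ofReal_mul,
      Finset.mul_sum]
    exact Finset.sum_congr rfl fun b _ => by ring
  simp only [hcol, hinner, star_mul', Complex.star_def, Complex.conj_ofReal]
  have hsum : ∑ a, (starRingEnd ℂ) z * ((perronVec c hc ℓ a : ℝ) : ℂ) *
      (z * (((arrowMatrix (G₂ := ZMod (2 * (ℓ + 1))) c 0 *ᵥ perronVec c hc ℓ) a : ℝ) : ℂ)) =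
      (starRingEnd ℂ) z * z *
        ((perronVec c hc ℓ ⬝ᵥ (arrowMatrix (G₂ := ZMod (2 * (ℓ + 1))) c 0 *ᵥ perronVec c hc ℓ) : ℝ) : ℂ) := by
    rw [dotProduct, Complex.ofReal_sum, Finset.mul_sum]
    refine Finset.sum_congr rfl fun a _ => ?_
    push_cast
    ring
  rw [hsum, dotProduct_mulVec_eq_zero_of_antisymm (arrowMatrix_transpose c 0), Complex.ofReal_zero, mul_zero]

/-! ### The limit identification and the Step 1 formula -/

/-- The real trace ratio of `torusPairExp_eq_trace_div_trace`, cast to `ℂ`, is the complexified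
trace ratio. [folklore] -/
theorem ofReal_torusPairExp_eq (y₁ y₂ : ZMod (2 * (ℓ + 1))) (x' s : ℕ) :
    ((torusPairExp c (0 + x' + 0 + s + 3) 0 (arrowObs y₁) (0 + 1 + x') 0 (arrowObs y₂) : ℝ) : ℂ) =
      (cpx (arrowMatrix (G₂ := ZMod (2 * (ℓ + 1))) c y₁) *
            cpx (balancedTransferMatrix (G₂ := ZMod (2 * (ℓ + 1))) 1 1 c) ^ x' *
            cpx (arrowMatrix (G₂ := ZMod (2 * (ℓ + 1))) c y₂) *
            cpx (balancedTransferMatrix (G₂ := ZMod (2 * (ℓ + 1))) 1 1 c) ^ (s + 1)).trace /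
        (cpx (balancedTransferMatrix (G₂ := ZMod (2 * (ℓ + 1))) 1 1 c) ^ (s + 1 + (0 + 1 + (0 + 1) + x'))).trace := by
  rw [torusPairExp_eq_trace_div_trace c (arrowObs y₁) (arrowObs y₂) x' s, Complex.ofReal_div,
    ← trace_cpx, ← trace_cpx, cpx_mul, cpx_mul, cpx_mul]
  unfold cpx
  rw [Matrix.map_pow, Matrix.map_pow, Matrix.map_pow]
  rfl

/-- **Theorem 23, Step 1 (vertical-arrow correlations in the joint eigenbasis).** For `c > 0`,
`L = 2(ℓ+1)`, rows `y₁, y₂` and a horizontal gap `x'`, the cylinder correlation of the vertical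
arrows `α_{y₁}` in column `0` and `α_{y₂}` in column `1 + x'` is
`𝔼_{CYL_L}[α_{y₁} · τ_{(1+x',0)} α_{y₂}] = -(∑_k |m_k|² λ_k^{x'} ω_k^{y₁} ω̄_k^{y₂}) / Λ^{x'+2}`,
i.e. `Φ_{CYL_L,2} = -∑_{k>0} |v_k† S v_0|² Λ_k(π/2)^{x₁'} Λ_k(0)^{-y₁'}` with `S = s_0/Λ`,
`Λ_k(π/2) = λ_k/Λ`, the phases `ω`, and `m_{k₀} = 0` (`topArrowCoeff_topIdx`).
[cite: DKLM2026SixVertexGFF, Theorem 23 and its proof, Step 1] -/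
theorem cylinderPairExp_arrowObs_eq (y₁ y₂ x' : ℕ) :
    ((cylinderPairExp c 0 (arrowObs ((y₁ : ℕ) : ZMod (2 * (ℓ + 1)))) (0 + 1 + x') 0
        (arrowObs ((y₂ : ℕ) : ZMod (2 * (ℓ + 1)))) : ℝ) : ℂ) =
      -(∑ k, (Complex.normSq (topArrowCoeff c hc ℓ k) : ℂ) * ((transferJointEigenvalue c ℓ k : ℝ) : ℂ) ^ x' *
          transferJointPhase c ℓ k ^ y₁ * star (transferJointPhase c ℓ k) ^ y₂) /
        ((topEigenvalue (balancedTransferMatrix_isHermitian (G₂ := ZMod (2 * (ℓ + 1))) 1 c) : ℝ) : ℂ) ^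
          (x' + 2) := by
  set Λ := topEigenvalue (balancedTransferMatrix_isHermitian (G₂ := ZMod (2 * (ℓ + 1))) 1 c) with hΛdef
  obtain ⟨δ, hδ, hdiag⟩ := exists_balancedTransferMatrix_diag_ge (G₂ := ZMod (2 * (ℓ + 1))) c hc
  have hΛ : 0 < Λ := topEigenvalue_pos_of_diag _ hδ hdiag
  -- the complex limit in the joint eigenbasis
  have hcpx := tendsto_trace_mul_cpx_pow_mul_mul_cpx_pow_div (transferJointUnitary_mul_star c ℓ)
    (star_mul_transferJointUnitary c ℓ) (cpx_transfer_mul_jointUnitary c ℓ) hΛ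
    (transferJointEigenvalue_topIdx c hc ℓ) (fun k hk => abs_transferJointEigenvalue_lt_top c hc ℓ hk)
    (cpx (arrowMatrix (G₂ := ZMod (2 * (ℓ + 1))) c (y₁ : ZMod (2 * (ℓ + 1)))))
    (cpx (arrowMatrix (G₂ := ZMod (2 * (ℓ + 1))) c (y₂ : ZMod (2 * (ℓ + 1))))) x' (0 + 1 + (0 + 1) + x')
  have hcpx1 := hcpx.comp (tendsto_add_atTop_nat 1)
  -- the real limit (Theorem 26 / Lemma 22), cast to `ℂ`
  have hreal : Tendsto (fun M : ℕ => torusPairExp c M 0 (arrowObs ((y₁ : ℕ) : ZMod (2 * (ℓ + 1))))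
      (0 + 1 + x') 0 (arrowObs ((y₂ : ℕ) : ZMod (2 * (ℓ + 1))))) atTop
      (𝓝 (cylinderPairExp c 0 (arrowObs ((y₁ : ℕ) : ZMod (2 * (ℓ + 1)))) (0 + 1 + x') 0
        (arrowObs ((y₂ : ℕ) : ZMod (2 * (ℓ + 1)))))) := by
    rw [cylinderPairExp_eq_sum c hc]
    exact tendsto_torusPairExp c hc _ _ x'
  have hreal' := ((Complex.continuous_ofReal.tendsto _).comp hreal).comp
    (tendsto_add_atTop_nat (0 + x' + 0 + 3) |>.comp (tendsto_id))
  -- the two sequences agree: index `s ↦ M = x' + s + 3`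
  have hseq : (fun s : ℕ => ((torusPairExp c (s + (0 + x' + 0 + 3)) 0 (arrowObs ((y₁ : ℕ) : ZMod (2 * (ℓ + 1))))
        (0 + 1 + x') 0 (arrowObs ((y₂ : ℕ) : ZMod (2 * (ℓ + 1)))) : ℝ) : ℂ)) =
      fun s : ℕ => (cpx (arrowMatrix (G₂ := ZMod (2 * (ℓ + 1))) c y₁) *
            cpx (balancedTransferMatrix (G₂ := ZMod (2 * (ℓ + 1))) 1 1 c) ^ x' *
            cpx (arrowMatrix (G₂ := ZMod (2 * (ℓ + 1))) c y₂) *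
            cpx (balancedTransferMatrix (G₂ := ZMod (2 * (ℓ + 1))) 1 1 c) ^ (s + 1)).trace /
        (cpx (balancedTransferMatrix (G₂ := ZMod (2 * (ℓ + 1))) 1 1 c) ^ (s + 1 + (0 + 1 + (0 + 1) + x'))).trace := by
    funext s
    rw [show s + (0 + x' + 0 + 3) = 0 + x' + 0 + s + 3 by omega]
    exact ofReal_torusPairExp_eq c ℓ _ _ x' s
  have hlim_eq := tendsto_nhds_unique (hreal'.congr (fun s => by
    simp only [Function.comp_apply, id]
    exact congrFun hseq s)) hcpx1
  rw [hlim_eq]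
  -- simplify the joint-basis expression
  congr 1
  · rw [← Finset.sum_neg_distrib]
    refine Finset.sum_congr rfl fun k _ => ?_
    rw [conj_arrowMatrix_top_apply, conj_arrowMatrix_apply_top, conj_arrowMatrix_zero_apply_top,
      Complex.normSq_eq_conj_mul_self]
    simp only [Complex.star_def]
    ring
  · norm_num [add_comm, add_assoc]

end StepOne

end Literature.Probability.LatticeModels.SixVertex

end
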